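import Mathlib.LinearAlgebra.Matrix.Determinant.Basic
import Mathlib.Data.Real.Basic

/-!
# Route SliceSignRank — crux `SrkNotQP` (stmt-ValiantsHypothesis-20857): a kernel-checked
# four-twist sign-representation of `sgn` on `S_5` (`srk(5) ≤ 4`)

Companion of `SliceSignRankSrkNotQPTwoTwistsFour` (`srk(4) ≤ 2`).  The route file records
`srk(5) = 4` from a kit computation (j003249, nonlinear feasibility) with "no Lean certificate format
yet"; the UPPER bound half is certifiable by an explicit witness and `decide`.  The integer witness
below (entries in `[-3, 3]`, found by simulated annealing in the isotropy census of line
`forster_slice`, `Cruxes/SrkNotQP/IsotropyCensusP2.md`) has `sgn(σ) · F(σ) ≥ 1` for all `120`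
permutations, `F(σ) = Σ_{t<4} Π_i W_t(σ i, i)`:

  `W₀ = [[1,3,3,−2,2],[3,0,−2,0,2],[1,−3,1,−2,2],[3,0,1,0,−3],[−1,1,−2,−1,−2]]`
  `W₁ = [[2,0,2,3,1],[−1,−3,0,3,−3],[−3,−3,−3,0,3],[0,1,−3,2,0],[−3,2,1,0,0]]`
  `W₂ = [[−2,2,1,−3,−1],[2,−1,−2,−2,−2],[−1,−2,−3,1,−1],[−1,−2,2,−1,1],[1,−2,2,2,−2]]`
  `W₃ = [[3,−1,3,−2,0],[−1,−1,2,2,−3],[1,−1,−3,−3,−3],[3,−1,−2,3,1],[−3,−1,0,−1,1]]`   (rows `a`, columns `i`).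

Isotropy data (census, not re-certified here): `det W_t = 996, 1560, 652, 1222` (total mass
`Σ_σ|F| = 4430`), `per(W_t∘W_t) = 70466, 220104, 35820, 84666`, isotropy constant
`K = 120 · 411056 / 4430² ≈ 2.51 < k = 4`; the landed `forsterSlice_of_isotropyConstant` predicts a
term with `120·per ≤ K·k·det² ≈ 10.05·det²`, and indeed terms `0` and `3` have ratios `8.52`, `6.80`.

Consequences: `exists_four_twists_signRep_five` (inner predicate of `SrkNotQP` / `SignRankSuperQP` at
`n = 5, k = 4`), `srkNotQP_not_witnessed_at_five` (for `c ≥ 1` the `∃ n` of `SrkNotQP` is not `5`;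
for `c = 0` the bound is `k ≤ 2` and the matching LOWER bound `srk(5) > 2` is NOT certified here).
Honest framing: finite calibration; the lower bound `srk(5) ≥ 4` stays kit-only; `SrkNotQP`,
`SignRankSuperQP`, `stub_forsterSlice` remain OPEN; `VP ≠ VNP` is not touched.  No `def`s, no
`native_decide`; `maxRecDepth` is raised for the `decide` over the `120` permutations only.
-/

-- Sub = Summit layout duplicates the namespace component
set_option linter.dupNamespace false

namespace Summit.ValiantsHypothesis.ValiantsHypothesis.Theorems.SliceSignRank.SrkNotQP

open Equiv

-- `decide` over `Perm (Fin 5)` (120 elements) needs a deeper recursion budget than the default.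
set_option maxRecDepth 100000 in
/-- **The integer witness for `srk(5) ≤ 4`**: for the four `5 × 5` integer twists of the module
docstring, `sgn(σ) · Σ_t Π_i W_t(σ i, i) ≥ 1` for every `σ ∈ S_5`.  Kernel-checked by `decide`
(120 permutations). [this file; witness from the isotropy census] -/
theorem four_twists_signRep_five_int (A B C D : Matrix (Fin 5) (Fin 5) ℤ)
    (hA : A = !![1, 3, 3, -2, 2; 3, 0, -2, 0, 2; 1, -3, 1, -2, 2; 3, 0, 1, 0, -3; -1, 1, -2, -1, -2])
    (hB : B = !![2, 0, 2, 3, 1; -1, -3, 0, 3, -3; -3, -3, -3, 0, 3; 0, 1, -3, 2, 0; -3, 2, 1, 0, 0])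
    (hC : C = !![-2, 2, 1, -3, -1; 2, -1, -2, -2, -2; -1, -2, -3, 1, -1; -1, -2, 2, -1, 1;
      1, -2, 2, 2, -2])
    (hD : D = !![3, -1, 3, -2, 0; -1, -1, 2, 2, -3; 1, -1, -3, -3, -3; 3, -1, -2, 3, 1;
      -3, -1, 0, -1, 1]) :
    ∀ σ : Perm (Fin 5), 1 ≤ ((Perm.sign σ : ℤˣ) : ℤ) *
      ((∏ i, A (σ i) i) + (∏ i, B (σ i) i) + (∏ i, C (σ i) i) + ∏ i, D (σ i) i) := by
  subst hA hB hC hD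
  decide

/-- **`srk(5) ≤ 4`, in the route's vocabulary**: four real twists sign-represent `sgn` on `S_5`
(the inner predicate of `SrkNotQP` / `SignRankSuperQP` at `n = 5`, `k = 4`; cast of the integer
witness). [this file] -/
theorem exists_four_twists_signRep_five :
    ∃ W : Fin 4 → Matrix (Fin 5) (Fin 5) ℝ,
      ∀ σ : Perm (Fin 5), 0 < ((Perm.sign σ : ℤ) : ℝ) * ∑ t, ∏ i, W t (σ i) i := by
  set A : Matrix (Fin 5) (Fin 5) ℤ :=
    !![1, 3, 3, -2, 2; 3, 0, -2, 0, 2; 1, -3, 1, -2, 2; 3, 0, 1, 0, -3; -1, 1, -2, -1, -2] with hA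
  set B : Matrix (Fin 5) (Fin 5) ℤ :=
    !![2, 0, 2, 3, 1; -1, -3, 0, 3, -3; -3, -3, -3, 0, 3; 0, 1, -3, 2, 0; -3, 2, 1, 0, 0] with hB
  set C : Matrix (Fin 5) (Fin 5) ℤ :=
    !![-2, 2, 1, -3, -1; 2, -1, -2, -2, -2; -1, -2, -3, 1, -1; -1, -2, 2, -1, 1; 1, -2, 2, 2, -2]
    with hC
  set D : Matrix (Fin 5) (Fin 5) ℤ :=
    !![3, -1, 3, -2, 0; -1, -1, 2, 2, -3; 1, -1, -3, -3, -3; 3, -1, -2, 3, 1; -3, -1, 0, -1, 1]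
    with hD
  refine ⟨![A.map (Int.cast : ℤ → ℝ), B.map (Int.cast : ℤ → ℝ), C.map (Int.cast : ℤ → ℝ),
    D.map (Int.cast : ℤ → ℝ)], fun σ => ?_⟩
  have h := four_twists_signRep_five_int A B C D hA hB hC hD σ
  have h' : (0 : ℤ) < ((Perm.sign σ : ℤˣ) : ℤ) *
      ((∏ i, A (σ i) i) + (∏ i, B (σ i) i) + (∏ i, C (σ i) i) + ∏ i, D (σ i) i) := by omega
  have hcast : ((Perm.sign σ : ℤ) : ℝ) * ∑ t, ∏ i, (![A.map (Int.cast : ℤ → ℝ),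
      B.map (Int.cast : ℤ → ℝ), C.map (Int.cast : ℤ → ℝ), D.map (Int.cast : ℤ → ℝ)] :
        Fin 4 → Matrix (Fin 5) (Fin 5) ℝ) t (σ i) i =
      ((((Perm.sign σ : ℤˣ) : ℤ) * ((∏ i, A (σ i) i) + (∏ i, B (σ i) i) + (∏ i, C (σ i) i) +
        ∏ i, D (σ i) i) : ℤ) : ℝ) := by
    push_cast
    simp [Fin.sum_univ_four, Matrix.map_apply, add_assoc]
  rw [hcast]
  exact_mod_cast h'

/-- **Calibration of the binder at `n = 5`**: for every `c ≥ 1` (so that `4 ≤ 2^((log₂ 5 + c)^c)`),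
the `∃ n` of `SrkNotQP` is not witnessed by `n = 5`.  (For `c = 0` the clause asks for no
representation with `k ≤ 2`, i.e. the kit-only lower bound `srk(5) > 2`, not certified here.)
[this file] -/
theorem srkNotQP_not_witnessed_at_five (c : ℕ) (hc : 1 ≤ c) :
    ¬ ∀ k ≤ 2 ^ ((Nat.log 2 5 + c) ^ c), ¬ ∃ W : Fin k → Matrix (Fin 5) (Fin 5) ℝ,
      ∀ σ : Perm (Fin 5), 0 < ((Perm.sign σ : ℤ) : ℝ) * ∑ t, ∏ i, W t (σ i) i := by
  intro h
  have hlog : Nat.log 2 5 = 2 := by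
    rw [Nat.log_eq_iff (Or.inl two_ne_zero)]
    norm_num
  have h4 : 4 ≤ 2 ^ ((Nat.log 2 5 + c) ^ c) := by
    rw [hlog]
    obtain ⟨c', rfl⟩ := Nat.exists_eq_add_of_le hc
    calc 4 = 2 ^ 2 := by norm_num
      _ ≤ 2 ^ ((2 + (1 + c')) ^ (1 + c')) := by
          refine Nat.pow_le_pow_right two_pos ?_
          calc 2 ≤ 2 + (1 + c') := Nat.le_add_right 2 _
            _ = (2 + (1 + c')) ^ 1 := (pow_one _).symm
            _ ≤ (2 + (1 + c')) ^ (1 + c') :=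
                Nat.pow_le_pow_right (by omega) (Nat.le_add_right 1 c')
  exact h 4 h4 exists_four_twists_signRep_five

end Summit.ValiantsHypothesis.ValiantsHypothesis.Theorems.SliceSignRank.SrkNotQP
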